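import Literature.AlgebraicGeometry.AbelianSchemes.PoincareUniversalLocality
import Mathlib.AlgebraicGeometry.Sites.Fpqc
import HarnessLib

/-!
# fpqc descent of the classifying map: local solutions glue when solutions are unique

Layer `Literature/AlgebraicGeometry/AbelianSchemes`, namespace `Literature.AlgebraicGeometry.AbelianSchemes.AbelianSchemeOver`.
THEOREMS ONLY; no definition, no named fact, no instance, no notation, no `sorry`.

Setting of ★ `PoincareUniversalLocality` ([MumfordAV1970] §13 p. 125; [MilneAV2008] I §8): an abelian scheme `A/S`, a would-be
dual `B/S`, a module `P` on `A ×_S B`; a SOLUTION for a test datum `(f : T → S, L)` (`L` a module on `A_T`) is an `S`-morphism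
`g : T → B` with `(1_A × g)^* P ≅ L`.  ★ `RigidifiedGluing` / `existsUnique_classify_of_affine` glue solutions along ZARISKI covers
of `T`; here the cover is fpqc (`c : T₁ → T` surjective, flat, quasi-compact — the case forced by the two-step descent of the
Poincaré sheaf to a quotient `A/K`, where test families lift only after the finite flat base changes `[n] : Â → Â`, `ψ̂ : Â → Â/K′`):

* `nonempty_pullback_prodMap_prodMap_iso` — `(1 × a)^* (1 × c)^* L ≅ (1 × (a ≫ c))^* L` (★ `prodMap_comp`);
* **`comp_eq_comp_of_solution_of_unique`** — if solutions are UNIQUE over every test scheme (hypothesis `huniq`, e.g. ★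
  `eq_of_pullback_baseChangeToProd_iso_of_stabilizer`) and `g₁ : T₁ → B` solves the pulled-back datum `(c ≫ f, (1 × c)^* L)`,
  then `g₁` coequalises every pair `a, b : Z → T₁` with `a ≫ c = b ≫ c` (both `a ≫ g₁`, `b ≫ g₁` solve the datum pulled back to `Z`);
* **`exists_desc_of_solution_of_unique`** — hence `g₁` DESCENDS along the effective epimorphism `c` (Mathlib: surjective + flat +
  quasi-compact ⇒ `EffectiveEpi`; [GortzWedhorn2020] Thm. 14.72): there is `g : T → B` over `f` with `c ≫ g = g₁` — the
  classifying map is defined over `T` as soon as it is defined fpqc-locally;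
* `eq_desc_of_comp_eq` — and it is the only `S`-morphism with `c ≫ g = g₁` (`cancel_epi`).

(The isomorphism `(1_A × g)^* P ≅ L` itself does NOT descend for free: for rigidified `P`, `L` it needs «rigidified line bundles on
`A_T` trivial fpqc-locally on `T` are trivial», i.e. the Stein property of `A_T → T`; that is a separate brick.)  Cell `hodgecm-mathlib`,
HECKE-LINK H2 (ii) D6 brick (u6a).  HC_CM is proved only modulo the 7 printed citations until rung 0 closes; nothing here is about HC.

## References
* [MumfordAV1970] D. Mumford, *Abelian Varieties* (1970), §13 (p. 125), §15 Thm. 1 (p. 143).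
* [MilneAV2008] J. S. Milne, *Abelian Varieties* (2008), I §8 (pp. 36–37).
* [GortzWedhorn2020] U. Görtz, T. Wedhorn, *Algebraic Geometry I*, 2nd ed. (2020), Thm. 14.72 (fpqc descent of morphisms).
-/

noncomputable section

universe u

open CategoryTheory CategoryTheory.Limits AlgebraicGeometry

namespace Literature.AlgebraicGeometry.AbelianSchemes

namespace AbelianSchemeOver

variable {S : Scheme.{u}} (A B : AbelianSchemeOver S) (P : (A.prodLeft B).Modules)

/-- `(1_A × d)^* (1_A × c)^* L ≅ (1_A × (d ≫ c))^* L` for base morphisms `Z —d→ T₁ —c→ T` over `S` (★ `prodMap_comp`).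
[cite: GortzWedhorn2020, Section (4.7) (pp. 107–108)] -/
theorem nonempty_pullback_prodMap_prodMap_iso {Z T₁ T : Scheme.{u}} (f : T ⟶ S) (c : T₁ ⟶ T) (F : Z ⟶ S) (d : Z ⟶ T₁)
    (hd : d ≫ c ≫ f = F) (L : (A.baseChange f).X.left.Modules) :
    Nonempty ((Scheme.Modules.pullback (A.prodMap F (c ≫ f) d hd)).obj
        ((Scheme.Modules.pullback (A.prodMap (c ≫ f) f c rfl)).obj L) ≅
      (Scheme.Modules.pullback (A.prodMap F f (d ≫ c) (by rw [Category.assoc, hd]))).obj L) :=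
  ⟨(Scheme.Modules.pullbackComp _ _).app L ≪≫
    (Scheme.Modules.pullbackCongr (A.prodMap_comp F (c ≫ f) f d hd c rfl)).app L⟩

variable {A B P}

/-- **A solution of the pulled-back datum coequalises the kernel of the cover, when solutions are unique.**  If for every
test scheme two solutions of the same datum coincide (`huniq`), `c : T₁ → T`, and `g₁ : T₁ → B` over `c ≫ f` satisfies
`(1 × g₁)^* P ≅ (1 × c)^* L`, then `a ≫ g₁ = b ≫ g₁` for all `a b : Z → T₁` with `a ≫ c = b ≫ c` (both sides solve the datum
`((a ≫ c) ≫ f, (1 × (a ≫ c))^* L)` on `Z`). [cite: MumfordAV1970, §13 (p. 125)] [cite: MilneAV2008, I §8 (pp. 36–37)] -/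
theorem comp_eq_comp_of_solution_of_unique
    (huniq : ∀ {T : Scheme.{u}} (f : T ⟶ S) (g₁ g₂ : T ⟶ B.X.left) (hg₁ : g₁ ≫ B.X.hom = f) (hg₂ : g₂ ≫ B.X.hom = f),
      Nonempty ((Scheme.Modules.pullback (A.baseChangeToProd B f g₁ hg₁)).obj P ≅
        (Scheme.Modules.pullback (A.baseChangeToProd B f g₂ hg₂)).obj P) → g₁ = g₂)
    {T₁ T : Scheme.{u}} (f : T ⟶ S) (c : T₁ ⟶ T) (L : (A.baseChange f).X.left.Modules) (g₁ : T₁ ⟶ B.X.left)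
    (hg₁ : g₁ ≫ B.X.hom = c ≫ f)
    (e₁ : Nonempty ((Scheme.Modules.pullback (A.baseChangeToProd B (c ≫ f) g₁ hg₁)).obj P ≅
      (Scheme.Modules.pullback (A.prodMap (c ≫ f) f c rfl)).obj L))
    {Z : Scheme.{u}} (a b : Z ⟶ T₁) (hab : a ≫ c = b ≫ c) : a ≫ g₁ = b ≫ g₁ := by
  obtain ⟨e₁⟩ := e₁
  have ha : (a ≫ g₁) ≫ B.X.hom = (a ≫ c) ≫ f := by rw [Category.assoc, hg₁, Category.assoc]
  have hb : (b ≫ g₁) ≫ B.X.hom = (a ≫ c) ≫ f := by rw [Category.assoc, hg₁, ← Category.assoc, ← hab]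
  -- both composites solve the datum pulled back to `Z`
  have sol : ∀ (d : Z ⟶ T₁) (hd : d ≫ c = a ≫ c),
      Nonempty ((Scheme.Modules.pullback (A.baseChangeToProd B ((a ≫ c) ≫ f) (d ≫ g₁)
          (by rw [Category.assoc, hg₁, ← Category.assoc, hd]))).obj P ≅
        (Scheme.Modules.pullback (A.prodMap ((a ≫ c) ≫ f) f (a ≫ c) rfl)).obj L) := by
    intro d hd
    have hd' : d ≫ c ≫ f = (a ≫ c) ≫ f := by rw [← Category.assoc, hd]
    obtain ⟨i⟩ := A.nonempty_pullback_prodMap_prodMap_iso f c ((a ≫ c) ≫ f) d hd' L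
    have hsq := A.prodMap_comp_baseChangeToProd B ((a ≫ c) ≫ f) (c ≫ f) d hd' g₁ hg₁
    exact ⟨(Scheme.Modules.pullbackCongr hsq.symm).app P ≪≫ ((Scheme.Modules.pullbackComp _ _).app P).symm ≪≫
      (Scheme.Modules.pullback (A.prodMap ((a ≫ c) ≫ f) (c ≫ f) d hd')).mapIso e₁ ≪≫ i ≪≫
      (Scheme.Modules.pullbackCongr (A.prodMap_congr ((a ≫ c) ≫ f) f hd _ rfl)).app L⟩
  obtain ⟨ia⟩ := sol a rfl
  obtain ⟨ib⟩ := sol b hab.symm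
  exact huniq ((a ≫ c) ≫ f) (a ≫ g₁) (b ≫ g₁) ha hb ⟨ia ≪≫ ib.symm⟩

/-- **fpqc descent of the classifying map.**  If solutions are unique over every test scheme (`huniq`), `c : T₁ → T` is an fpqc
cover (surjective, flat, quasi-compact) and the pulled-back datum `(c ≫ f, (1 × c)^* L)` has a solution `g₁` on `T₁`, then there
is an `S`-morphism `g : T → B` over `f` with `c ≫ g = g₁` (Mathlib `EffectiveEpi.desc`: an fpqc cover is an effective epimorphism of
schemes). [cite: GortzWedhorn2020, Thm. 14.72] [cite: MumfordAV1970, §13 (p. 125)] -/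
theorem exists_desc_of_solution_of_unique
    (huniq : ∀ {T : Scheme.{u}} (f : T ⟶ S) (g₁ g₂ : T ⟶ B.X.left) (hg₁ : g₁ ≫ B.X.hom = f) (hg₂ : g₂ ≫ B.X.hom = f),
      Nonempty ((Scheme.Modules.pullback (A.baseChangeToProd B f g₁ hg₁)).obj P ≅
        (Scheme.Modules.pullback (A.baseChangeToProd B f g₂ hg₂)).obj P) → g₁ = g₂)
    {T₁ T : Scheme.{u}} (f : T ⟶ S) (c : T₁ ⟶ T) [Surjective c] [Flat c] [QuasiCompact c]
    (L : (A.baseChange f).X.left.Modules) (g₁ : T₁ ⟶ B.X.left) (hg₁ : g₁ ≫ B.X.hom = c ≫ f)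
    (e₁ : Nonempty ((Scheme.Modules.pullback (A.baseChangeToProd B (c ≫ f) g₁ hg₁)).obj P ≅
      (Scheme.Modules.pullback (A.prodMap (c ≫ f) f c rfl)).obj L)) :
    ∃ g : T ⟶ B.X.left, g ≫ B.X.hom = f ∧ c ≫ g = g₁ := by
  have hco : ∀ {Z : Scheme.{u}} (a b : Z ⟶ T₁), a ≫ c = b ≫ c → a ≫ g₁ = b ≫ g₁ :=
    fun a b hab => comp_eq_comp_of_solution_of_unique huniq f c L g₁ hg₁ e₁ a b hab
  refine ⟨EffectiveEpi.desc c g₁ hco, ?_, EffectiveEpi.fac c g₁ hco⟩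
  rw [← cancel_epi c, EffectiveEpi.fac_assoc, hg₁]

/-- The descended morphism is unique among `g` with `c ≫ g = g₁` (`c` is an epimorphism). [cite: GortzWedhorn2020, Thm. 14.72] -/
theorem eq_of_cover_comp_eq {T₁ T : Scheme.{u}} (c : T₁ ⟶ T) [Surjective c] [Flat c] [QuasiCompact c]
    {g g' : T ⟶ B.X.left} (h : c ≫ g = c ≫ g') : g = g' :=
  (cancel_epi c).mp h

end AbelianSchemeOver

end Literature.AlgebraicGeometry.AbelianSchemes

end
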